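import Mathlib
import Literature.NumberTheory.Transcendental.LinEDS
import Literature.NumberTheory.Transcendental.LinEDSCode
import Literature.NumberTheory.Transcendental.MultipleZetaStuffle
import HarnessLib

/-!
# E2 — stuffle parity: the bitset harmonic product `LinEDS.stBits` is `MZV.stuffle` mod 2

Soundness of the harmonic-product half of the kernel-checkable GF(2) rank engine
`Literature/NumberTheory/Transcendental/LinEDS.lean` for the linearised extended double shuffle
system: for indices `s`, `t`, bit `i` of `LinEDS.stBits s t` is the parity of the number of indices
`u` (counted with multiplicity) in Hoffman's harmonic product `MZV.stuffle s t` with `icode u = i`.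

The proof is the functional induction of `MZV.stuffle` (rules (A1)–(A3) of [Hoffman1997, §2]):
`stBits` follows the same recursion with `++` replaced by `^^^` (parities add) and
`map (List.cons c)` replaced by the shift `<<< 2 ^ m`, `m` the common weight of the indices of the
set, because `icode (c :: v) = 2 ^ v.sum + icode v` and the harmonic product is homogeneous for the
weight (`MZV.sum_of_mem_stuffle`). No injectivity of `icode` is needed for this parity count, so
the positivity hypotheses of the registered statement are not used in the proof.
-/

namespace Summit.KontsevichZagierPeriods.FurushoPentagon.KernelModuloPeriodConjecture

open Literature.NumberTheory.Transcendental

/-- Parities add: `Odd (m + n)` is the exclusive or of `Odd m` and `Odd n`. [folklore] -/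
theorem stBitsE2_decide_odd_add (m n : ℕ) :
    decide (Odd (m + n)) = (decide (Odd m) ^^ decide (Odd n)) := by
  rcases Nat.mod_two_eq_zero_or_one m with hm | hm <;>
    rcases Nat.mod_two_eq_zero_or_one n with hn | hn <;>
      simp [Nat.odd_iff, Nat.add_mod, hm, hn]

/-- The shift step: if bit `j` of `X` is the parity of the number of `v ∈ L` with `icode v = j`
(every `j`) and all members of `L` have weight `m`, then bit `i` of `X <<< 2 ^ m` is the parity of
the number of `u ∈ L.map (c :: ·)` with `icode u = i` — prepending a letter to indices of weight
`m` adds `2 ^ m` to their codes. [folklore] -/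
theorem stBitsE2_testBit_shiftLeft_map_cons (X m c i : ℕ) (L : List (List ℕ))
    (hL : ∀ v ∈ L, v.sum = m)
    (hX : ∀ j, X.testBit j = decide (Odd (L.countP fun v => decide (LinEDS.icode v = j)))) :
    (X <<< 2 ^ m).testBit i =
      decide (Odd ((L.map (List.cons c)).countP fun u => decide (LinEDS.icode u = i))) := by
  rw [Nat.testBit_shiftLeft, List.countP_map]
  by_cases h : 2 ^ m ≤ i
  · rw [hX, decide_eq_true (show i ≥ 2 ^ m from h), Bool.true_and]
    congr 2
    refine List.countP_congr fun v hv => ?_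
    simp only [Function.comp_apply, LinEDS.icode, hL v hv, decide_eq_true_eq]
    omega
  · have h0 : L.countP ((fun u => decide (LinEDS.icode u = i)) ∘ List.cons c) = 0 := by
      rw [List.countP_eq_zero]
      intro v hv
      simp only [Function.comp_apply, LinEDS.icode, hL v hv, decide_eq_true_eq]
      omega
    rw [h0]
    simp [h]

/-- **Stuffle parity, Boolean form.** Bit `i` of `stBits s t` is the parity of the multiplicity
count `#{u ∈ s ∗ t : icode u = i}`, by functional induction on Hoffman's rules (A1)–(A3).
[cite: Hoffman1997, §2] -/
theorem stBitsE2_testBit_eq : ∀ (s t : List ℕ) (i : ℕ),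
    (LinEDS.stBits s t).testBit i =
      decide (Odd ((MZV.stuffle s t).countP fun u => decide (LinEDS.icode u = i))) := by
  intro s t
  induction s, t using MZV.stuffle.induct with
  | case1 t =>
    intro i
    rw [MZV.stuffle_nil_left, show LinEDS.stBits [] t = 2 ^ LinEDS.icode t from rfl,
      Nat.testBit_two_pow]
    by_cases h : LinEDS.icode t = i <;> simp [h]
  | case2 a s =>
    intro i
    rw [MZV.stuffle_nil_right,
      show LinEDS.stBits (a :: s) [] = 2 ^ LinEDS.icode (a :: s) from rfl, Nat.testBit_two_pow]
    by_cases h : LinEDS.icode (a :: s) = i <;> simp [h]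
  | case3 a s b t ih1 ih2 ih3 =>
    intro i
    have h1 := stBitsE2_testBit_shiftLeft_map_cons (LinEDS.stBits s (b :: t))
      (s.sum + (b + t.sum)) a i (MZV.stuffle s (b :: t))
      (fun v hv => by rw [MZV.sum_of_mem_stuffle s (b :: t) hv, List.sum_cons]) ih1
    have h2 := stBitsE2_testBit_shiftLeft_map_cons (LinEDS.stBits (a :: s) t)
      (a + s.sum + t.sum) b i (MZV.stuffle (a :: s) t)
      (fun v hv => by rw [MZV.sum_of_mem_stuffle (a :: s) t hv, List.sum_cons]) ih2
    have h3 := stBitsE2_testBit_shiftLeft_map_cons (LinEDS.stBits s t)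
      (s.sum + t.sum) (a + b) i (MZV.stuffle s t)
      (fun v hv => by rw [MZV.sum_of_mem_stuffle s t hv]) ih3
    rw [MZV.stuffle_cons_cons, List.countP_append, List.countP_append, stBitsE2_decide_odd_add,
      stBitsE2_decide_odd_add, ← h1, ← h2, ← h3,
      show LinEDS.stBits (a :: s) (b :: t) =
        ((LinEDS.stBits s (b :: t)) <<< (2 ^ (s.sum + (b + t.sum)))) ^^^
          (((LinEDS.stBits (a :: s) t) <<< (2 ^ (a + s.sum + t.sum))) ^^^
            ((LinEDS.stBits s t) <<< (2 ^ (s.sum + t.sum)))) from rfl,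
      Nat.testBit_xor, Nat.testBit_xor]

/-- **E2 — stuffle parity.** For indices `s`, `t` (positive entries), bit `i` of the bitset
harmonic product `LinEDS.stBits s t` is set iff the number of indices `u` in Hoffman's harmonic
product `s ∗ t = MZV.stuffle s t` (with multiplicity) having `icode u = i` is odd: the engine's
`stBits` is the harmonic product reduced mod 2. [cite: Hoffman1997, §2] -/
theorem stub_stBits_testBit :
    ∀ (s t : List ℕ), (∀ a ∈ s, 1 ≤ a) → (∀ b ∈ t, 1 ≤ b) → ∀ i : ℕ,
      (LinEDS.stBits s t).testBit i = true ↔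
        Odd ((MZV.stuffle s t).countP fun u => decide (LinEDS.icode u = i)) := by
  intro s t _ _ i
  rw [stBitsE2_testBit_eq]
  exact decide_eq_true_iff

end Summit.KontsevichZagierPeriods.FurushoPentagon.KernelModuloPeriodConjecture
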